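import Literature.MathematicalPhysics.QuantumManyBody.PeriodicKineticBudget
import HarnessLib

/-!
# Route `BECPhaseQuadratureSumRule`, glue `SumRuleChainGlue` (stmt-AtomisticToContinuum-12627) —
# helper: counting the infrared modes `0 < ‖k‖ < K₀` of the torus (`d = 3`)

The infrared window of the chain is the finite set of labels `p ∈ ℤ³ ∖ 0` with `‖k_p‖ < K₀`, `k_p = 2πp/L`
(`K₀ = Λ√(ρa)`). Writing `M = L K₀ / 2π`:

* `mem_box_of_norm_kvec_lt` — such `p` lie in the cube `{-⌈M⌉, …, ⌈M⌉}³` (so the window is a finite set and the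
  crux's indicator-`tsum` is a finite sum);
* `card_irWindow_le` — `#window ≤ 192 M³` once `M ≥ 1` (shell counting, tree: `card_supNorm_le`);
* `sum_inv_norm_kvec_le` — `Σ_window ‖k_p‖⁻¹ ≤ 96 (L/2π) M²` (tree: `sum_inv_supNorm_le`; this is where `d = 3`
  enters: `Σ_{0<|p|≤M} |p|⁻¹ = O(M²)`).

All statements are over the explicit finite set
`(Fintype.piFinset fun _ => Finset.Icc (-⌈M⌉₊) ⌈M⌉₊).filter (p ≠ 0 ∧ ‖k_p‖ < K₀)`.
-/

noncomputable section

open Finset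
open scoped BigOperators

namespace Summit.AtomisticToContinuum.BoseEinsteinCondensation.Theorems.SumRuleChainGlue

open Literature.MathematicalPhysics.QuantumManyBody.BoseGas

variable {L K₀ : ℝ}

/-- `‖k_p‖ = (2π/L) ‖p‖₂`. -/
theorem norm_kvec_eq (hL : 0 < L) (p : Fin 3 → ℤ) :
    ‖(2 * Real.pi / L) • latticeVec 1 p‖ = 2 * Real.pi / L * ‖latticeVec 1 p‖ := by
  rw [norm_smul, Real.norm_of_nonneg (by positivity)]

/-- `|p_j| ≤ ‖p‖₂`. -/
theorem abs_apply_le_norm_latticeVec (p : Fin 3 → ℤ) (j : Fin 3) : |(p j : ℝ)| ≤ ‖latticeVec 1 p‖ := by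
  have h1 : ((p j : ℤ) : ℝ) ^ 2 ≤ ‖latticeVec 1 p‖ ^ 2 := by
    rw [norm_latticeVec_one_sq]
    exact Finset.single_le_sum (f := fun i => ((p i : ℤ) : ℝ) ^ 2) (fun i _ => sq_nonneg _) (mem_univ j)
  have h2 := Real.sqrt_le_sqrt h1
  rwa [Real.sqrt_sq_eq_abs, Real.sqrt_sq (norm_nonneg _)] at h2

/-- The sup norm is below the Euclidean norm: `|p|∞ ≤ ‖p‖₂`. -/
theorem supNorm_le_norm_latticeVec (p : Fin 3 → ℤ) :
    (((univ.sup fun j => (p j).natAbs : ℕ)) : ℝ) ≤ ‖latticeVec 1 p‖ := by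
  have h := supNorm_sq_le_nsq p
  rw [← norm_latticeVec_one_sq] at h
  nlinarith [norm_nonneg (latticeVec 1 p), Nat.cast_nonneg (α := ℝ) (univ.sup fun j => (p j).natAbs)]

/-- `‖k_p‖ < K₀` gives `‖p‖₂ < L K₀ / 2π`. -/
theorem norm_latticeVec_lt_of_norm_kvec_lt (hL : 0 < L) {p : Fin 3 → ℤ}
    (hp : ‖(2 * Real.pi / L) • latticeVec 1 p‖ < K₀) : ‖latticeVec 1 p‖ < L * K₀ / (2 * Real.pi) := by
  rw [norm_kvec_eq hL, div_mul_eq_mul_div, div_lt_iff₀ hL] at hp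
  rw [lt_div_iff₀ (by positivity)]
  linarith

/-- **The infrared labels lie in a cube**: `‖k_p‖ < K₀` forces `|p_j| ≤ ⌈L K₀/2π⌉` for every `j`. -/
theorem mem_box_of_norm_kvec_lt (hL : 0 < L) {p : Fin 3 → ℤ} (hp : ‖(2 * Real.pi / L) • latticeVec 1 p‖ < K₀) :
    p ∈ Fintype.piFinset fun _ : Fin 3 => Finset.Icc (-(⌈L * K₀ / (2 * Real.pi)⌉₊ : ℤ)) ⌈L * K₀ / (2 * Real.pi)⌉₊ := by
  rw [Fintype.mem_piFinset]
  intro j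
  rw [Finset.mem_Icc, ← abs_le]
  have h1 : ‖latticeVec 1 p‖ < L * K₀ / (2 * Real.pi) := norm_latticeVec_lt_of_norm_kvec_lt hL hp
  have h3 : |(p j : ℝ)| ≤ ⌈L * K₀ / (2 * Real.pi)⌉₊ :=
    ((abs_apply_le_norm_latticeVec p j).trans h1.le).trans (Nat.le_ceil _)
  have h4 : ((|p j| : ℤ) : ℝ) ≤ ((⌈L * K₀ / (2 * Real.pi)⌉₊ : ℤ) : ℝ) := by
    rw [Int.cast_abs]; exact_mod_cast h3
  exact_mod_cast h4

/-- **Cardinality of the infrared window**: with `M = L K₀/2π ≥ 1`, `#{p ≠ 0 : ‖k_p‖ < K₀} ≤ 192 M³`. -/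
theorem card_irWindow_le (hL : 0 < L) (hM : 1 ≤ L * K₀ / (2 * Real.pi)) :
    ((((Fintype.piFinset fun _ : Fin 3 => Finset.Icc (-(⌈L * K₀ / (2 * Real.pi)⌉₊ : ℤ)) ⌈L * K₀ / (2 * Real.pi)⌉₊).filter
        fun p => p ≠ 0 ∧ ‖(2 * Real.pi / L) • latticeVec 1 p‖ < K₀).card : ℕ) : ℝ) ≤
      192 * (L * K₀ / (2 * Real.pi)) ^ 3 := by
  set M : ℝ := L * K₀ / (2 * Real.pi) with hMdef
  set W := (Fintype.piFinset fun _ : Fin 3 => Finset.Icc (-(⌈M⌉₊ : ℤ)) ⌈M⌉₊).filter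
    fun p => p ≠ 0 ∧ ‖(2 * Real.pi / L) • latticeVec 1 p‖ < K₀ with hW
  have hsub : W ⊆ W.filter fun p => (univ.sup fun j => (p j).natAbs) ≤ ⌊M⌋₊ := by
    intro p hp
    rw [Finset.mem_filter]
    refine ⟨hp, ?_⟩
    rw [hW, Finset.mem_filter] at hp
    have h1 : ‖latticeVec 1 p‖ ≤ M := (norm_latticeVec_lt_of_norm_kvec_lt hL hp.2.2).le
    exact Nat.le_floor ((supNorm_le_norm_latticeVec p).trans h1)
  have hM0 : 0 ≤ M := by linarith
  calc ((W.card : ℕ) : ℝ) ≤ ((W.filter fun p => (univ.sup fun j => (p j).natAbs) ≤ ⌊M⌋₊).card : ℝ) := by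
        exact_mod_cast Finset.card_le_card hsub
    _ ≤ 24 * ((⌊M⌋₊ : ℝ) + 1) ^ 3 := card_supNorm_le W ⌊M⌋₊
    _ ≤ 24 * (M + 1) ^ 3 := by gcongr; exact Nat.floor_le hM0
    _ ≤ 24 * (2 * M) ^ 3 := by gcongr; linarith
    _ = 192 * M ^ 3 := by ring

/-- **The infrared lattice sum in `d = 3`**: `Σ_{p ≠ 0, ‖k_p‖ < K₀} ‖k_p‖⁻¹ ≤ 96 (L/2π) (L K₀/2π)²`. -/
theorem sum_inv_norm_kvec_le (hL : 0 < L) (hK₀ : 0 ≤ K₀) :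
    ∑ p ∈ (Fintype.piFinset fun _ : Fin 3 => Finset.Icc (-(⌈L * K₀ / (2 * Real.pi)⌉₊ : ℤ)) ⌈L * K₀ / (2 * Real.pi)⌉₊).filter
        (fun p => p ≠ 0 ∧ ‖(2 * Real.pi / L) • latticeVec 1 p‖ < K₀), ‖(2 * Real.pi / L) • latticeVec 1 p‖⁻¹ ≤
      96 * (L / (2 * Real.pi)) * (L * K₀ / (2 * Real.pi)) ^ 2 := by
  set M : ℝ := L * K₀ / (2 * Real.pi) with hMdef
  set W := (Fintype.piFinset fun _ : Fin 3 => Finset.Icc (-(⌈M⌉₊ : ℤ)) ⌈M⌉₊).filter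
    fun p => p ≠ 0 ∧ ‖(2 * Real.pi / L) • latticeVec 1 p‖ < K₀ with hW
  have hM0 : 0 ≤ M := by rw [hMdef]; positivity
  -- every term is below `(L/2π)/|p|∞`, and the window sits in `1 ≤ |p|∞ ≤ ⌊M⌋`
  have hfilt : W.filter (fun p => 1 ≤ (univ.sup fun j => (p j).natAbs) ∧ (univ.sup fun j => (p j).natAbs) ≤ ⌊M⌋₊) = W := by
    refine Finset.filter_true_of_mem fun p hp => ?_
    rw [hW, Finset.mem_filter] at hp
    refine ⟨one_le_supNorm_of_ne_zero hp.2.1, ?_⟩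
    have h1 : ‖latticeVec 1 p‖ ≤ M := (norm_latticeVec_lt_of_norm_kvec_lt hL hp.2.2).le
    exact Nat.le_floor ((supNorm_le_norm_latticeVec p).trans h1)
  have hle : ∀ p ∈ W, ‖(2 * Real.pi / L) • latticeVec 1 p‖⁻¹ ≤
      L / (2 * Real.pi) * ((((univ.sup fun j => (p j).natAbs : ℕ)) : ℝ))⁻¹ := by
    intro p hp
    rw [hW, Finset.mem_filter] at hp
    have hsup : (1 : ℝ) ≤ (((univ.sup fun j => (p j).natAbs : ℕ)) : ℝ) := by
      exact_mod_cast one_le_supNorm_of_ne_zero hp.2.1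
    rw [norm_kvec_eq hL, mul_inv, inv_div]
    refine mul_le_mul_of_nonneg_left ?_ (by positivity)
    exact inv_anti₀ (by linarith) (supNorm_le_norm_latticeVec p)
  calc ∑ p ∈ W, ‖(2 * Real.pi / L) • latticeVec 1 p‖⁻¹
      ≤ ∑ p ∈ W, L / (2 * Real.pi) * ((((univ.sup fun j => (p j).natAbs : ℕ)) : ℝ))⁻¹ := Finset.sum_le_sum hle
    _ = L / (2 * Real.pi) * ∑ p ∈ W.filter (fun p => 1 ≤ (univ.sup fun j => (p j).natAbs) ∧
          (univ.sup fun j => (p j).natAbs) ≤ ⌊M⌋₊), ((((univ.sup fun j => (p j).natAbs : ℕ)) : ℝ))⁻¹ := by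
        rw [hfilt, Finset.mul_sum]
    _ ≤ L / (2 * Real.pi) * (96 * (⌊M⌋₊ : ℝ) ^ 2) :=
        mul_le_mul_of_nonneg_left (sum_inv_supNorm_le W ⌊M⌋₊) (by positivity)
    _ ≤ L / (2 * Real.pi) * (96 * M ^ 2) := by gcongr; exact Nat.floor_le hM0
    _ = 96 * (L / (2 * Real.pi)) * M ^ 2 := by ring

end Summit.AtomisticToContinuum.BoseEinsteinCondensation.Theorems.SumRuleChainGlue

end
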